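import Summits.BirchSwinnertonDyer.BirchSwinnertonDyer.Theorems.UniversalToricDescentNoFiniteSubmoduleOfCoinvariants
import Summits.BirchSwinnertonDyer.Rank1Residual.O5.HeegnerLogTransportThreeExactCount
import HarnessLib

/-!
# Route UniversalToricDescent — (N1) at `Σ = ∅` for the WILD curve from the route's own inputs:
# rank one over the Heegner field, `Ш(E/K)` finite, `E(ℚ₃)[3] = 0`, and the two Poitou–Tate leaves

Lead prover bsd-wall-utd-p1 g7 (`--supports stmt-BirchSwinnertonDyer-20399`; PRICING-20399-ALG-HALF §3(b)).
`UniversalToricDescentNoFiniteSubmoduleOfCoinvariants.forall_finite_eq_bot_baseChange_of_noPTorsionPadic`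
delivers (N1) «`X_ac^∅(E_K[p^∞])` has no non-zero finite `Λ`-submodule» from the cited Poitou–Tate facts,
(iv) `E(ℚ_p)[p] = 0` and ONE arithmetic input: the finiteness of Castella's BASE Selmer groups
`Sel_v(K, E[p^∞])` at the primes `v ∣ p`. This file discharges that input at a rank-one datum from the
tree's exact base count (O5 `HeegnerLogTransport.natCard_selmerAcBase_eq_pow_of_noLocalTorsion`,
JSW17 Prop. 3.2.1 — any reduction type at `p`):

* §1 `finite_selmerAcBase_of_rankOne` — `rank E(K) = 1`, `Ш(E/K)` finite, a point of infinite order,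
  (iv), `K` imaginary quadratic with `p` split ⟹ `Sel_v(K, E[p^∞])` finite at every `v ∣ p` (all of
  degree one); `forall_finite_eq_bot_baseChange_of_rankOne` — hence (N1) and `X_ac^∅[T] = 0` for EVERY
  `ℤ_p`-extension `κ` and every strict place `𝔭 ∣ p`, GIVEN Poitou–Tate ×2.
* §2 `forall_finite_eq_bot_baseChange_three_of_rankOne` — the `p = 3` reading in the binders of crux #2 /
  21845 (`ClassO6 W 3`, `N = N(E)`, Heegner field `K`; the rank-one inputs are what Kolyvagin's theorem
  `kolyvagin N W K` yields from a non-torsion Heegner point, as in crux #5's closer).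

HONEST STATUS: helper theorems, CONDITIONAL on the cited `poitouTate_selmerStructure_duality K` and
`poitouTate_sha_tateDual K` (the route's open leaves 20461/20462); (N1) for the TWIN `E′` needs the same
rank-one inputs for `E′/K`, which 21845 does not carry; the `Σ`-level and the analytic half are untouched.
THEOREMS ONLY; no definition, no named fact, no `sorry`. BSD is not advanced by this file.
References: [JetchevSkinnerWan2017] Prop. 3.2.1, Lemma 3.3.3 (arXiv:1512.06894 pp. 10–12);
[GreenbergLNM1716] Prop. 4.14–4.15; [MilneADT2006] I 2.8, 4.10; [Kolyvagin1990] Thm. A.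
-/

set_option autoImplicit false
-- `…BirchSwinnertonDyer.BirchSwinnertonDyer.Theorems…` is the problem's mandated namespace (D-0017).
set_option linter.dupNamespace false

noncomputable section

open scoped Classical

namespace Summit.BirchSwinnertonDyer.BirchSwinnertonDyer.Theorems.UniversalToricDescentNoFiniteSubmodule

open NumberField IsDedekindDomain Field WeierstrassCurve
open Literature.NumberTheory.EllipticCurves Literature.NumberTheory.EllipticCurves.IwasawaAlgebra
  Literature.NumberTheory.EllipticCurves.GreenbergSelmer
  Literature.NumberTheory.GaloisRepresentations Literature.NumberTheory.GaloisCohomology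
  Literature.NumberTheory.EllipticCurves.Rank1Residual
  Summit.BirchSwinnertonDyer.Rank1Residual Summit.BirchSwinnertonDyer.Rank1Residual.X11b
  Summit.BirchSwinnertonDyer.Rank1Residual.X11b.AcSelmer

/-! ### §1 Base finiteness at a rank-one datum, and (N1) from it -/

section RankOne

variable (W : WeierstrassCurve ℚ) [W.IsElliptic] [W.IsGloballyMinimal] (p : ℕ) [Fact p.Prime]
  {K : Type} [Field K] [NumberField K]

/-- **`Sel_v(K, E[p^∞])` is finite at every `v ∣ p`, at a rank-one datum under (iv).** For `W/ℚ`
globally minimal with `E(ℚ_p)[p] = 0`, `K` imaginary quadratic with `p` split, `rank E(K) = 1`,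
`Ш(E/K)` finite and a point `P ∈ E(K)` of infinite order: every `v ∣ p` is of degree one
(`X11b.degreeOne_of_splitsIn`) and Castella's base Selmer group strict at `v` is finite of order
`p^a` (the tree's exact count `O5.HeegnerLogTransport.natCard_selmerAcBase_eq_pow_of_noLocalTorsion`,
JSW17 Prop. 3.2.1). CONDITIONAL on the cited Poitou–Tate duality for Selmer structures over `K`
(Milne I 2.8 at the completions is the tree theorem `EP.localEulerPoincareCharacteristic_adicCompletion`).
[cite: JetchevSkinnerWan2017, Prop. 3.2.1 (arXiv:1512.06894 pp. 10–11)] [cite: MilneADT2006, Ch. I, Thm. 4.10] -/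
theorem finite_selmerAcBase_of_rankOne
    (h4 : ∀ R : (W.baseChange ℚ_[p]).toAffine.Point, p • R = 0 → R = 0)
    (hK : IsImaginaryQuadratic K) (hsplit : SplitsIn K p) (hPT : poitouTate_selmerStructure_duality K)
    (hrank : (W.baseChange K).mordellWeilRank = 1) (hSha : (W.baseChange K).ShaFinite)
    (P : (W.baseChange K).toAffine.Point) (hP : ¬ IsOfFinAddOrder P) :
    ∀ v : HeightOneSpectrum (𝓞 K), ((p : ℕ) : 𝓞 K) ∈ v.asIdeal →
      Finite (selmerAcBase (W.baseChange K) p v ∅) := by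
  intro v hv
  obtain ⟨he, hf⟩ := degreeOne_of_splitsIn hK.1 hsplit hv
  obtain ⟨hfin, -⟩ :=
    O5.HeegnerLogTransport.natCard_selmerAcBase_eq_pow_of_noLocalTorsion W p h4 K hK hPT
      (fun w ↦ GaloisImage.EP.localEulerPoincareCharacteristic_adicCompletion K w) hrank hSha P hP v
      hv he hf
  exact hfin

/-- **(N1) and `X[T] = 0` for `X_ac^∅(E_K)` at a rank-one datum under (iv).** Same data, ANY
`ℤ_p`-extension `κ` of `K` with topological generator `γ`, any strict place `𝔭 ∣ p`: the dual
`X_ac^∅(E_K[p^∞])` (strict at `𝔭`) has no non-zero finite `Λ`-submodule and trivial `Γ`-invariants,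
GIVEN Poitou–Tate ×2 (`forall_finite_eq_bot_baseChange_of_noPTorsionPadic` + §1).
[cite: JetchevSkinnerWan2017, Lemma 3.3.3 and Prop. 3.2.1 (arXiv:1512.06894 pp. 10–12)]
[cite: GreenbergLNM1716, Prop. 4.14–4.15 (pp. 124–126)] [cite: MilneADT2006, Ch. I, Thm. 4.10] -/
theorem forall_finite_eq_bot_baseChange_of_rankOne
    (h4 : ∀ R : (W.baseChange ℚ_[p]).toAffine.Point, p • R = 0 → R = 0)
    (hK : IsImaginaryQuadratic K) (hsplit : SplitsIn K p)
    (hPT : poitouTate_selmerStructure_duality K) (hPT2 : poitouTate_sha_tateDual K)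
    (hrank : (W.baseChange K).mordellWeilRank = 1) (hSha : (W.baseChange K).ShaFinite)
    (P : (W.baseChange K).toAffine.Point) (hP : ¬ IsOfFinAddOrder P)
    (κ : ZpExtension K p) (γ : absoluteGaloisGroup K) [Fact (κ.IsTopGenerator γ)]
    {𝔭 : HeightOneSpectrum (𝓞 K)} (h𝔭 : ((p : ℕ) : 𝓞 K) ∈ 𝔭.asIdeal) :
    (∀ N : Submodule (IwasawaAlgebra p) (XAc (W.baseChange K) p κ 𝔭 ∅ γ), Finite N → N = ⊥) ∧
      invariants p (XAc (W.baseChange K) p κ 𝔭 ∅ γ) = ⊥ := by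
  obtain ⟨he, hf⟩ := degreeOne_of_splitsIn hK.1 hsplit h𝔭
  have hfin := finite_selmerAcBase_of_rankOne W p h4 hK hsplit hPT hrank hSha P hP
  exact ⟨forall_finite_eq_bot_baseChange_of_noPTorsionPadic W p h4 hPT hPT2 hK hsplit κ γ h𝔭 he hf hfin,
    invariants_eq_bot_baseChange_of_noPTorsionPadic W p h4 hPT hPT2 hK hsplit κ γ h𝔭 he hf hfin⟩

end RankOne

/-! ### §2 `p = 3`, binders of crux #2 / 21845 -/

section Three

variable (W : WeierstrassCurve ℚ) [W.IsElliptic] [W.IsGloballyMinimal] {K : Type} [Field K]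
  [NumberField K]

/-- **(N1) at `Σ = ∅` for the WILD curve of crux #2, from rank-one inputs.** `E/ℚ` wild at `3`
(`ClassO6 W 3`), `N = N(E)`, `K` imaginary quadratic Heegner for `N` (so `3` splits), `rank E(K) = 1`,
`Ш(E/K)` finite, `P ∈ E(K)` of infinite order (on the route: Kolyvagin from the non-torsion Heegner
point), (iv) `E(ℚ₃)[3] = 0`; ANY `ℤ₃`-extension `κ` with topological generator `γ`, any `𝔭′ ∋ 3` as the
strict place: `X_ac^∅(E_K[3^∞])` has no non-zero finite `Λ`-submodule and `X[T] = 0`, GIVEN the two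
cited Poitou–Tate facts (leaves 20461/20462). This is hypothesis `hnf` (at `Σ = ∅`, wild side) of
`UniversalToricDescentSigmaFreeTransport.pow_lambdaInvariant_mul_natCard_baseChange_eq_of_modPCongruent`.
[cite: JetchevSkinnerWan2017, Lemma 3.3.3 and Prop. 3.2.1 (arXiv:1512.06894 pp. 10–12)]
[cite: GreenbergLNM1716, Prop. 4.14–4.15 (pp. 124–126)] [cite: Kolyvagin1990, Thm. A] -/
theorem forall_finite_eq_bot_baseChange_three_of_rankOne {N : ℕ}
    (hO6 : Additive.ClassO6 W 3) (hN : W.conductorNorm ℤ = N) (hK : IsImaginaryQuadratic K)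
    (hHe : SatisfiesHeegnerHypothesis N K)
    (h4 : ∀ R : (W.baseChange ℚ_[3]).toAffine.Point, 3 • R = 0 → R = 0)
    (hPT : poitouTate_selmerStructure_duality K) (hPT2 : poitouTate_sha_tateDual K)
    (hrank : (W.baseChange K).mordellWeilRank = 1) (hSha : (W.baseChange K).ShaFinite)
    (P : (W.baseChange K).toAffine.Point) (hP : ¬ IsOfFinAddOrder P)
    (κ : ZpExtension K 3) (γ : absoluteGaloisGroup K) [Fact (κ.IsTopGenerator γ)]
    {𝔭' : HeightOneSpectrum (𝓞 K)} (h𝔭' : ((3 : ℕ) : 𝓞 K) ∈ 𝔭'.asIdeal) :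
    (∀ M : Submodule (IwasawaAlgebra 3) (XAc (W.baseChange K) 3 κ 𝔭' ∅ γ), Finite M → M = ⊥) ∧
      invariants 3 (XAc (W.baseChange K) 3 κ 𝔭' ∅ γ) = ⊥ := by
  have hadd : Addv W 3 := hO6.2.1
  have hpN : 3 ∣ W.conductorNorm ℤ :=
    (W.dvd_conductorNorm_iff_not_hasGoodReductionAtPrime 3).mpr hadd.1
  have hsplit : SplitsIn K 3 := hHe 3 (Fact.out) (hN ▸ hpN)
  exact forall_finite_eq_bot_baseChange_of_rankOne W 3 h4 hK hsplit hPT hPT2 hrank hSha P hP κ γ h𝔭'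

end Three

end Summit.BirchSwinnertonDyer.BirchSwinnertonDyer.Theorems.UniversalToricDescentNoFiniteSubmodule

end
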